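import Summits.HodgeConjecture.HodgeConjecture.Theorems.K2E3WittStandardIndexing
import Summits.HodgeConjecture.HodgeConjecture.Theorems.K2E3LocalUnitaryWittRefinement
import Mathlib.RingTheory.Valuation.ValuativeRel.Basic
import HarnessLib

/-!
# K2 ∕ E3 «EllipticInputs», 13a road A, J1-lite (Witt half): the Witt coweight of a simple root `α` — labels of the maximal parabolic
# `P_{univ ∖ {α}}`, the coweight as a function of the label, and its diagonal RATIOS (`≤ 1` along a standard indexing, `≤ |ϖ|` across the break)

Cell `hodgecm-mathlib` (Track B «K2-LIT»), item h413 = `stmt-HodgeConjecture-24833`; author K2E3-p10 (g2); count-neutral helper for the 13a line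
(road A; the hypotheses `hw ∕ hwq ∕ hw'` of ★ `K2E3BlockRadicalRayLevels` for `t = wittCocharacterGL σ e α ϖ = diag(wittCoweight σ α ϖ ∘ e⁻¹)`
(★ `K2E3LocalUnitaryWittDefs`) and the labelling `c = wittBlockOn e (univ.erase α)` (★ `K2E3LocalUnitaryWittParabolicDefs`) in a standard indexing).
PROOF lane: theorems only (no `def`, no `instance`, no `sorry`).

* §1 (labels of the maximal parabolic of `α` = ★ K2-defs1 `wittBlockNat_univ_erase_*`: `[α < i] ∣ 1 ∣ 1 + [rev α ≤ j]`) `wittBlockNat_erase_le_two`,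
  **`coe_wittCoweight_eq_of_label`** — the coweight is `ϖ ∕ 1 ∕ (σϖ)⁻¹` on the labels `0 ∕ 1 ∕ 2`.
* §2 over a field with a `ValuativeRel` and `|σ ϖ| = |ϖ| ≤ 1`: **`valuation_wittCoweight_ratio_le_one`** (`label x ≤ label y ⇒ |d_x d_y⁻¹| ≤ 1`),
  **`valuation_wittCoweight_ratio_le`** (`label x < label y ⇒ |d_x d_y⁻¹| ≤ |ϖ|`), and the positional forms in a standard indexing
  `valuation_wittCoweight_ratio_le_one_of_lt` ∕ `valuation_wittCoweight_ratio_le_of_label_lt` (`i < j`; via ★ `monotone_wittBlockOn_of_std`).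

References: A. Borel, *Linear Algebraic Groups* (1991), §23; W. Casselman (1995), proof of Thm. 5.3.1.
-/

set_option autoImplicit false
set_option linter.dupNamespace false

namespace Summit.HodgeConjecture.HodgeConjecture.Cruxes.H413.K2E3WittCoweightRatios

open Literature.NumberTheory.Automorphic K2E3LocalUnitaryWitt K2E3WittStandardIndexing
open scoped MatrixGroups

/-! ## §1 Labels of the maximal parabolic of `α` and the coweight as a function of the label -/

section Labels

variable {r m : ℕ} (α : Fin r)

/-- Every label of the maximal parabolic of `α` is `≤ 2`. [cite: Borel1991, §23] -/
theorem wittBlockNat_erase_le_two (x : WittIndex r m) : wittBlockNat (Finset.univ.erase α) x ≤ 2 := by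
  rcases x with i | u | j
  · rw [wittBlockNat_univ_erase_inl]; split_ifs <;> omega
  · rw [wittBlockNat_univ_erase_inr_inl]; omega
  · rw [wittBlockNat_univ_erase_inr_inr]; split_ifs <;> omega

variable {R : Type*} [CommRing R] (σ : R →+* R) (ϖ : Rˣ)

/-- **The coweight as a function of the label**: `wittCoweight σ α ϖ x` is `ϖ`, `1`, `(σϖ)⁻¹` according as the label of `x` for the maximal parabolic
of `α` is `0`, `1`, `2`. [cite: Borel1991, §23] -/
theorem coe_wittCoweight_eq_of_label (x : WittIndex r m) :
    (wittCoweight (m := m) σ α ϖ x : R) =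
      if wittBlockNat (Finset.univ.erase α) x = 0 then (ϖ : R)
      else if wittBlockNat (Finset.univ.erase α) x = 1 then 1 else (((Units.map (σ : R →* R) ϖ)⁻¹ : Rˣ) : R) := by
  rcases x with i | u | j
  · rw [wittCoweight_inl, wittBlockNat_univ_erase_inl]
    by_cases h : i.val ≤ α.val
    · rw [if_pos h, if_neg (show ¬ α.val < i.val by omega), if_pos rfl]
    · rw [if_neg h, if_pos (show α.val < i.val by omega), if_neg (show (1 : ℕ) ≠ 0 by omega), if_pos rfl, Units.val_one]
  · rw [wittCoweight_inr_inl, wittBlockNat_univ_erase_inr_inl, if_neg (show (1 : ℕ) ≠ 0 by omega), if_pos rfl, Units.val_one]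
  · rw [wittCoweight_inr_inr, wittBlockNat_univ_erase_inr_inr]
    by_cases h : (Fin.rev j).val ≤ α.val
    · have h' : (Fin.rev α).val ≤ j.val := by rw [Fin.val_rev] at h ⊢; omega
      rw [if_pos h, if_pos h', if_neg (show (1 + 1 : ℕ) ≠ 0 by omega), if_neg (show (1 + 1 : ℕ) ≠ 1 by omega)]
    · have h' : ¬ (Fin.rev α).val ≤ j.val := by rw [Fin.val_rev] at h ⊢; omega
      rw [if_neg h, if_neg h', if_neg (show (1 + 0 : ℕ) ≠ 0 by omega), if_pos (show (1 + 0 : ℕ) = 1 by omega), Units.val_one]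

end Labels

/-! ## §2 Ratios of the coweight -/

section Ratios

open ValuativeRel

variable {K : Type*} [Field K] [ValuativeRel K] (σ : K →+* K) {r m : ℕ} (α : Fin r) (ϖ : Kˣ)
  (hϖ1 : valuation K (ϖ : K) ≤ 1) (hσϖ : valuation K (σ ϖ) = valuation K (ϖ : K))

include hϖ1 hσϖ

/-- **`label x ≤ label y ⇒ |d_x d_y⁻¹| ≤ 1`** for the Witt coweight `d` of `α` (`|σϖ| = |ϖ| ≤ 1`). [cite: Casselman1995, proof of Thm. 5.3.1] -/
theorem valuation_wittCoweight_ratio_le_one (x y : WittIndex r m)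
    (hxy : wittBlockNat (Finset.univ.erase α) x ≤ wittBlockNat (Finset.univ.erase α) y) :
    valuation K ((wittCoweight σ α ϖ x : K) * ((wittCoweight σ α ϖ y : K))⁻¹) ≤ 1 := by
  have hσ0 : (σ ϖ : K) ≠ 0 := by
    intro h; have := hσϖ; rw [h, map_zero] at this
    exact (Units.ne_zero ϖ) ((map_eq_zero (valuation K)).1 this.symm)
  have hx2 := wittBlockNat_erase_le_two (m := m) α x
  have hy2 := wittBlockNat_erase_le_two (m := m) α y
  have hcoe : (((Units.map (σ : K →* K) ϖ)⁻¹ : Kˣ) : K) = (σ ϖ : K)⁻¹ := by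
    rw [Units.val_inv_eq_inv_val, Units.coe_map]; rfl
  rw [coe_wittCoweight_eq_of_label α σ ϖ x, coe_wittCoweight_eq_of_label α σ ϖ y, hcoe]
  -- case analysis on the two labels `0 ∕ 1 ∕ 2` with `label x ≤ label y`
  rcases Nat.lt_or_ge (wittBlockNat (Finset.univ.erase α) x) 1 with hx | hx <;>
  rcases Nat.lt_or_ge (wittBlockNat (Finset.univ.erase α) y) 1 with hy | hy
  · rw [if_pos (by omega), if_pos (by omega), mul_inv_cancel₀ (Units.ne_zero ϖ), map_one]
  · by_cases hy1 : wittBlockNat (Finset.univ.erase α) y = 1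
    · rw [if_pos (by omega), if_neg (by omega), if_pos hy1, inv_one, mul_one]; exact hϖ1
    · rw [if_pos (by omega), if_neg (by omega), if_neg hy1, inv_inv, map_mul]
      change valuation K (ϖ : K) * valuation K (σ ϖ) ≤ 1
      rw [hσϖ]; exact mul_le_one' hϖ1 hϖ1
  · exfalso; omega
  · by_cases hx1 : wittBlockNat (Finset.univ.erase α) x = 1
    · by_cases hy1 : wittBlockNat (Finset.univ.erase α) y = 1
      · rw [if_neg (by omega), if_pos hx1, if_neg (by omega), if_pos hy1, inv_one, mul_one, map_one]
      · rw [if_neg (by omega), if_pos hx1, if_neg (by omega), if_neg hy1, inv_inv, one_mul]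
        change valuation K (σ ϖ) ≤ 1
        rw [hσϖ]; exact hϖ1
    · have hy1 : wittBlockNat (Finset.univ.erase α) y ≠ 1 := by omega
      rw [if_neg (by omega), if_neg hx1, if_neg (by omega), if_neg hy1, mul_inv_cancel₀ (inv_ne_zero hσ0), map_one]

/-- **`label x < label y ⇒ |d_x d_y⁻¹| ≤ |ϖ|`**: ACROSS the break of the maximal parabolic of `α` the Witt coweight contracts by at least `|ϖ|`
(`ϖ ∕ 1`, `1 ∕ (σϖ)⁻¹`, `ϖ ∕ (σϖ)⁻¹` have ratios `ϖ`, `σϖ`, `ϖσϖ`). [cite: Casselman1995, proof of Thm. 5.3.1] -/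
theorem valuation_wittCoweight_ratio_le (x y : WittIndex r m)
    (hxy : wittBlockNat (Finset.univ.erase α) x < wittBlockNat (Finset.univ.erase α) y) :
    valuation K ((wittCoweight σ α ϖ x : K) * ((wittCoweight σ α ϖ y : K))⁻¹) ≤ valuation K (ϖ : K) := by
  have hy2 := wittBlockNat_erase_le_two (m := m) α y
  have hcoe : (((Units.map (σ : K →* K) ϖ)⁻¹ : Kˣ) : K) = (σ ϖ : K)⁻¹ := by
    rw [Units.val_inv_eq_inv_val, Units.coe_map]; rfl
  rw [coe_wittCoweight_eq_of_label α σ ϖ x, coe_wittCoweight_eq_of_label α σ ϖ y, hcoe]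
  rcases Nat.lt_or_ge (wittBlockNat (Finset.univ.erase α) x) 1 with hx | hx
  · by_cases hy1 : wittBlockNat (Finset.univ.erase α) y = 1
    · rw [if_pos (by omega), if_neg (by omega), if_pos hy1, inv_one, mul_one]
    · rw [if_pos (by omega), if_neg (by omega), if_neg hy1, inv_inv, map_mul, hσϖ]
      exact mul_le_of_le_one_right' hϖ1
  · have hx1 : wittBlockNat (Finset.univ.erase α) x = 1 := by omega
    have hy1 : wittBlockNat (Finset.univ.erase α) y ≠ 1 := by omega
    rw [if_neg (by omega), if_pos hx1, if_neg (by omega), if_neg hy1, inv_inv, one_mul, hσϖ]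

variable {N : ℕ} (e : WittIndex r m ≃ Fin N)
  (hstd : ∀ x, (e x).val = Sum.elim (fun i : Fin r => i.val) (Sum.elim (fun u : Fin m => r + u.val) (fun j : Fin r => r + m + j.val)) x)

include hstd

/-- **Positional form, `≤ 1`**: in a standard indexing, `i < j ⇒ |d_i d_j⁻¹| ≤ 1` for `d = wittCoweight σ α ϖ ∘ e⁻¹` (labels are monotone along positions,
★ `monotone_wittBlockOn_of_std`). [cite: Casselman1995, proof of Thm. 5.3.1] -/
theorem valuation_wittCoweight_ratio_le_one_of_lt (i j : Fin N) (hij : i < j) :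
    valuation K ((wittCoweight σ α ϖ (e.symm i) : K) * ((wittCoweight σ α ϖ (e.symm j) : K))⁻¹) ≤ 1 := by
  refine valuation_wittCoweight_ratio_le_one σ α ϖ hϖ1 hσϖ _ _ ?_
  have h := monotone_wittBlockOn_of_std e hstd (Finset.univ.erase α) hij.le
  rw [Fin.le_iff_val_le_val, wittBlockOn_apply, wittBlockOn_apply, wittBlock_val, wittBlock_val] at h
  exact h

omit hstd in
/-- **Positional form, `≤ |ϖ|` across blocks**: `i < j` and `label i < label j ⇒ |d_i d_j⁻¹| ≤ |ϖ|` (the `hwq` hypothesis of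
★ `K2E3BlockRadicalRayLevels.exists_mem_blockRayLevel` for `c = wittBlockOn e (univ.erase α)`). [cite: Casselman1995, proof of Thm. 5.3.1] -/
theorem valuation_wittCoweight_ratio_le_of_label_lt (i j : Fin N)
    (hc : wittBlockOn e (Finset.univ.erase α) i < wittBlockOn e (Finset.univ.erase α) j) :
    valuation K ((wittCoweight σ α ϖ (e.symm i) : K) * ((wittCoweight σ α ϖ (e.symm j) : K))⁻¹) ≤ valuation K (ϖ : K) := by
  refine valuation_wittCoweight_ratio_le σ α ϖ hϖ1 hσϖ _ _ ?_
  rw [Fin.lt_def, wittBlockOn_apply, wittBlockOn_apply, wittBlock_val, wittBlock_val] at hc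
  exact hc

end Ratios

end Summit.HodgeConjecture.HodgeConjecture.Cruxes.H413.K2E3WittCoweightRatios
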